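import Summits.QuantumFields.YangMills.Theorems.BalabanUVNodesN27ReadOutAtU3OfKernels
import Summits.QuantumFields.YangMills.Theorems.BalabanUVNodesN18AtU3OfKernels
import Summits.QuantumFields.YangMills.Theorems.BalabanUVNodesN18KernelStepRateBoxes
import Summits.QuantumFields.YangMills.Theorems.BalabanUVNodesN17AtSpineCarriers
import Literature.MathematicalPhysics.QuantumFieldTheory.Balaban1983to89.Node00.Record13SepCoPH

/-!
# BalabanUVNodes ∕ node N17 = NE4 AT def-W1's KERNEL OBJECTS OF RECORD `Node00.U3OfKernels.objectsOfRecord₁₃ F N θ ℓ` (W1-20): THE N17 ROW OF THE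
# «U3-OF-KERNELS» CLUSTER — what N17 SAYS there (one scale-shift sentence about `betaOfRecord₁₃` in the letter block `ℓ`), the DERIVED ROW there
# (N17 ⇐ N18 ∧ (5.10) decay ∧ letter signs — no N22, no separate (D4) hypothesis: (D4) is dag-n27-w1's THEOREM at these objects), the guard-free
# service to K2⁷ v3's shared stub `stub_n17AtRecord13`, and the pin form a K3⁷ stub-1 prover meets

Cell `pub-ymgap` (HUMAN RULINGS D-0062 ∕ D-0149), WIDTH SEAT `pub-ymgap-dag-n17-w1` (seat 1 of 3 on NODE n17), generation 2, second module.  THEOREMS ONLY (0 `def`,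
0 `sorry`); `--kind proof --supports stmt-QuantumFields-20544 --as helper` (K3⁷); serves K2⁷ stmt-QuantumFields-20543's `stub_n17AtRecord13` BY NAME (its body SPELLED,
N-generic; at `N := 2` it is the registered text).  Companion of the landed U3-of-kernels modules: def-W1's W1-19∕W1-20 `Node00/U3OfKernels` (the objects,
`representsA∕B_objectsOfRecord₁₃` BY CONSTRUCTION, the (5.10) binder `KernelDecayOfRecord₁₃`), dag-n27-w1's `…N27ReadOutAtU3OfKernels` ((D4) `ReadOutAt` at the objects of
record is a THEOREM from `ℓ.Signs`, `0 < ℓ.κ`, `betaPrime510 4 1 ℓ.κ ≤ ℓ.cr`, `KernelDecayOfRecord₁₃`), dag-n18-w1's `…N18AtU3OfKernels` (`N18At` there ⟺ the η-rate of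
consecutive-level limiting kernels) and `…N18KernelStepRateBoxes` p594018 (N18 + (UD) ⟹ the scale-shift rate of the merged β of record).  Plan g81 (t-U3): K3⁷ v3 is cut on these objects — this is node N17's row there, landed ahead of the cut.

WHAT THIS FILE PROVES (kernel bookkeeping BY NAME; every estimate a displayed hypothesis).
* §1 WHAT N17 SAYS AT THE KERNEL OBJECTS (`Iff.rfl` ×4): at the generic objects `objects F ℰ ρ bV ℓ` and at the objects of record, for ANY datum ∕ the CoPH ∕ the ⁷ SepCoPH
  datum of record: `N17At D (u3OfRecord₁₃ θ (objectsOfRecord₁₃ F N θ ℓ) k) ↔ ScaleShiftRate (ℓ.cr·ℓ.C₅·ℓ.θ₅) ℓ.ρ θ.γ D.βfun` — ONE sentence in the letter block, level-free,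
  carriers ∕ functionals unread (the objects only fix WHICH β: `betaOfRecord₁₃`).
* §2 ★ THE DERIVED ROW AT THE OBJECTS OF RECORD: `n17At_objectsOfRecord₁₃_coPH_of_n18At` — `ℓ.Signs`, `0 < ℓ.κ`, `betaPrime510 4 1 ℓ.κ ≤ ℓ.cr`, the (5.10) clause of
  record `KernelDecayOfRecord₁₃ F N θ.toStage13Params 0 1 ℓ.κ` AND `N18At` at the objects of record ⟹ `N17At` at the CoPH datum of record on the same bundle
  (dag-n27-w1 `readOutAt_objectsOfRecord₁₃_coPH` ∘ dag-n17-a `YMDAG.N17.n17At_of_readOutAt`); `…_sepCoPH_of_n18At` (⁷ keys, along `Provisos₁₃SepCoPH.toCore`, datum `rfl`);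
  ★ `scaleShiftRate_betaOfRecord₁₃_of_n18At_objectsOfRecord₁₃` — the same CONCLUSION SPELLED: «NE4 for `betaOfRecord₁₃ F N θ.toStage13Params` with constant `ℓ.cr·ℓ.C₅·ℓ.θ₅`,
  rate `ℓ.ρ`, window `θ.γ`» from N18 at the kernel objects + (5.10) + signs; `…_of_kernelStepRate` (N18 replaced by dag-n18-w1's kernel-currency `iff`, BY NAME).
  HONEST: (5.10) is PRINTED for Bałaban's kernels ([I] p. 293) and a HYPOTHESIS here; the kernel step rate = NE5 is NOT PRINTED; nothing is discharged.
  ★ `n17At_objectsOfRecord₁₃_coPH_of_kernelRoad` — THE TWO ROADS AGREE: dag-n18-w1's kernel-road conclusion `ScaleShiftRate (betaPrime510 4 (ℓ.C₅·ℓ.θ₅) ℓ.κ) ℓ.θ₅ θ.γ β₁₃`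
  lands N17 AT THE OBJECTS BUNDLE ITSELF exactly under (D4)'s input `betaPrime510 4 1 ℓ.κ ≤ ℓ.cr` + signs (`betaPrime510_eq_one_mul`, `N17_mono`).
  `n17At_objectsOfRecord₁₃_coPH_of_n18At_UD` — hence dag-n18-w1's landed p594018 `scaleShiftRate_betaMergedOfRecord_of_n18At_objectsOfRecord₁₃` (N18 + (UD)) lands N17 at the bundle BY NAME.
* §3 ★ THE GUARD-FREE SERVICE TO K2⁷'s SHARED STUB: `n17AtRecord13Body_of_n18At_objectsOfRecord₁₃` — if at every admissible ⁷ tuple SOME letter block `ℓ` with the four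
  read-out inputs carries `N18At` at the objects of record, then K2⁷ v3's `N17AtRecord13` body holds, witness `u :=` the objects-of-record bundle (`u.γ = θ.γ` by `rfl`,
  `0 ≤ u.ρ < 1` = `ℓ.Signs.ρ_nonneg ∕ .ρ_lt_one`).  No unity ∕ slot guard is read — this road serves K2⁷ AND K3⁷ (seat g2's first module, §3 there, for the guarded side).
* §4 THE PIN FORM (reading side, dag-n18-w1's `…_of_kernels_pin` shape): for a Stage-13 rate reading `𝔯` whose node-U3 objects at a tuple ARE the objects of record
  (`hpin`), the N17 conjunct at EVERY run-length bundle `(rateCarriersOfRecord₁₃CoPH 𝔯 F θ hP g₀ os k).u3` ⟸ the N18 conjunct there + the four read-out inputs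
  (`n17At_rateCarriers_of_kernels_pin_of_n18At`), and READS as §1's sentence (`n17At_rateCarriers_of_kernels_pin_iff`).

HONEST FRAMING.  Count-neutral helper lane; by-name rows over W1-19∕W1-20 ∕ dag-n27-w1 ∕ dag-n18-w1 ∕ dag-n17-a; nothing of Bałaban's asserted; NE4 NOT IN PRINT ([Balaban1987RG1]
p. 264 «separate paper»), NE5 NOT PRINTED for d = 4, (5.10) a hypothesis; N17 ∕ N18 NOT discharged; K2⁷ ∕ K3⁷ OPEN, NOT claimed; counts unmoved (typed 28∕28 · discharged 5∕27,
A 5∕28); one finite 𝕋⁴ programme at fixed ε — the YM mass gap (Clay) is NOT proved by any of this; R4 closes the conditional finite-𝕋⁴ rung `BalabanLadder.UV` only; nothing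
continuum ∕ ℝ⁴ ∕ OS.
-/

noncomputable section

open scoped Matrix.Norms.L2Operator

namespace YMDAG.N17.AtU3OfKernels

open Literature.MathematicalPhysics.QuantumFieldTheory.Balaban1983to89
open Literature.MathematicalPhysics.QuantumFieldTheory.Balaban1983to89.T4CouplingMatching (ScaleShiftRate)
open Literature.MathematicalPhysics.QuantumFieldTheory.Balaban1983to89.T4Continuum (T4Family ULoop)
open Literature.MathematicalPhysics.QuantumFieldTheory.Balaban1983to89.B12Sec2to5 (betaPrime510)
open Node00 (Stage13Params Stage13HParams U3Letters₁₁ datumOfRecord₁₃CoPH datumOfRecord₁₃SepCoPH betaOfRecord₁₃)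
open Node00.U3OfKernels (objects objectsOfRecord₁₃ KernelDecayOfRecord₁₃ pt)
open Summit.QuantumFields.BalabanUV.T4Continuum.Spine.NE4 (NE4OnData)
open Summit.QuantumFields.YangMills.BalabanUVNodes.N27ReadOutAtU3OfKernels (readOutAt_objectsOfRecord₁₃_coPH)
open YMDAG.N18.AtU3OfKernels (n18At_u3OfRecord₁₃_objectsOfRecord₁₃_iff)
open YMDAG.UVSplit

variable {F : T4Family} {N : ℕ} [NeZero N]

/-! ## §1 What N17 says at the kernel objects: one sentence in the letter block (`Iff.rfl`) -/

section Says

variable {𝔄 : Type*} [NormedRing 𝔄] [NormedAlgebra ℝ 𝔄] {V : Type*} [NormedAddCommGroup V] [NormedSpace ℝ V] {ι : Type*} [Fintype ι]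

/-- **AT THE GENERIC KERNEL OBJECTS `objects F ℰ ρ bV ℓ`, ANY DATUM**: `N17At D (u3OfRecord₁₃ θ (objects …) k) ↔ NE4OnData D (ℓ.cr·ℓ.C₅·ℓ.θ₅) ℓ.ρ θ.γ` — the letter block's
`cr, C₅, θ₅, ρ` and the window `θ.γ`; the kernel carrier and the two level functionals are not read by N17 (`Iff.rfl`). [bookkeeping] -/
theorem n17At_u3OfRecord₁₃_objects_iff (ℰ : Node00.TermFamily1 F 𝔄) (ρ : V →L[ℝ] 𝔄) (bV : Module.Basis ι ℝ V) (θ : Stage13Params F N) (ℓ : U3Letters₁₁)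
    (k : ℕ) (D : Datum F N) :
    N17At D (u3OfRecord₁₃ θ (objects F ℰ ρ bV ℓ) k) ↔ NE4OnData D (ℓ.cr * ℓ.C₅ * ℓ.θ₅) ℓ.ρ θ.γ :=
  Iff.rfl

end Says

/-- **AT THE OBJECTS OF RECORD, ANY DATUM** (`Iff.rfl`). [bookkeeping] -/
theorem n17At_u3OfRecord₁₃_objectsOfRecord₁₃_iff (θ : Stage13Params F N) (ℓ : U3Letters₁₁) (k : ℕ) (D : Datum F N) :
    N17At D (u3OfRecord₁₃ θ (objectsOfRecord₁₃ F N θ ℓ) k) ↔ NE4OnData D (ℓ.cr * ℓ.C₅ * ℓ.θ₅) ℓ.ρ θ.γ :=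
  Iff.rfl

/-- **AT NODE 00's v1.7 STAGE-13 DATUM `datumOfRecord₁₃CoPH F N θ hP` ON THE OBJECTS OF RECORD**: N17 IS «NE4 for def-T's `betaOfRecord₁₃ F N θ.toStage13Params` with constant
`ℓ.cr·ℓ.C₅·ℓ.θ₅`, rate `ℓ.ρ`, window `θ.γ`» (`Node00.βfun_datumOfRecord₁₃CoPH`, `rfl`). [cite: Balaban1987RG1, (1.20)-(1.22) p.264] -/
theorem n17At_objectsOfRecord₁₃_datumOfRecord₁₃CoPH_iff (θ : Stage13HParams F N) (hP : θ.Provisos₁₃CoPH F N) (ℓ : U3Letters₁₁) (k : ℕ) :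
    N17At (datumOfRecord₁₃CoPH F N θ hP) (u3OfRecord₁₃ θ.toStage13Params (objectsOfRecord₁₃ F N θ.toStage13Params ℓ) k) ↔
      ScaleShiftRate (ℓ.cr * ℓ.C₅ * ℓ.θ₅) ℓ.ρ θ.γ (betaOfRecord₁₃ F N θ.toStage13Params) :=
  Iff.rfl

/-- **… AT THE ⁷ DATUM `datumOfRecord₁₃SepCoPH F N θ hP`** (K2⁷ ∕ K3⁷'s item key; `Node00.βfun_datumOfRecord₁₃SepCoPH`, `rfl`). [cite: Balaban1987RG1, (1.20)-(1.22) p.264] -/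
theorem n17At_objectsOfRecord₁₃_datumOfRecord₁₃SepCoPH_iff (θ : Stage13HParams F N) (hP : θ.Provisos₁₃SepCoPH F N) (ℓ : U3Letters₁₁) (k : ℕ) :
    N17At (datumOfRecord₁₃SepCoPH F N θ hP) (u3OfRecord₁₃ θ.toStage13Params (objectsOfRecord₁₃ F N θ.toStage13Params ℓ) k) ↔
      ScaleShiftRate (ℓ.cr * ℓ.C₅ * ℓ.θ₅) ℓ.ρ θ.γ (betaOfRecord₁₃ F N θ.toStage13Params) :=
  Iff.rfl

/-! ## §2 The derived row at the objects of record: N17 ⇐ N18 ∧ (5.10) decay ∧ letter signs -/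

/-- ★ **N17 AT THE OBJECTS OF RECORD FROM N18 THERE, THE (5.10) CLAUSE OF RECORD AND THE LETTER SIGNS** (v1.7 CoPH datum): the β-read-out binders (D4) at the objects of record
are dag-n27-w1's THEOREM `readOutAt_objectsOfRecord₁₃_coPH` from `ℓ.Signs`, `0 < ℓ.κ`, `betaPrime510 4 1 ℓ.κ ≤ ℓ.cr` (the read-out domination letter dominates the (5.10)
moment sum) and `KernelDecayOfRecord₁₃ F N θ.toStage13Params 0 1 ℓ.κ`; with `N18At` at the same bundle, dag-n17-a's U3 → U2 edge `YMDAG.N17.n17At_of_readOutAt` gives N17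
there — NO N22, NO separate (D4) hypothesis.  (5.10) PRINTED for Bałaban's kernels, a hypothesis here; NE5 NOT PRINTED. [cite: Balaban1987RG1, (1.20)-(1.22) p.264 and (5.10) p.293] -/
theorem n17At_objectsOfRecord₁₃_coPH_of_n18At (θ : Stage13HParams F N) (hP : θ.Provisos₁₃CoPH F N) (ℓ : U3Letters₁₁) (hs : ℓ.Signs) (hκ : 0 < ℓ.κ)
    (hcr : betaPrime510 4 1 ℓ.κ ≤ ℓ.cr) (k : ℕ) (hdec : KernelDecayOfRecord₁₃ F N θ.toStage13Params 0 1 ℓ.κ)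
    (h18 : N18At (u3OfRecord₁₃ θ.toStage13Params (objectsOfRecord₁₃ F N θ.toStage13Params ℓ) k)) :
    N17At (datumOfRecord₁₃CoPH F N θ hP) (u3OfRecord₁₃ θ.toStage13Params (objectsOfRecord₁₃ F N θ.toStage13Params ℓ) k) :=
  YMDAG.N17.n17At_of_readOutAt _ (readOutAt_objectsOfRecord₁₃_coPH θ hP ℓ hs hκ hcr k hdec) h18

/-- **… AT THE ⁷ KEYS** (`Provisos₁₃SepCoPH`, along def-T's `.toCore`; the datum is the same term, `datumOfRecord₁₃SepCoPH_eq_coPH` by `rfl`). [cite: Balaban1987RG1, (1.20)-(1.22) p.264 and (5.10) p.293] -/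
theorem n17At_objectsOfRecord₁₃_sepCoPH_of_n18At (θ : Stage13HParams F N) (hP : θ.Provisos₁₃SepCoPH F N) (ℓ : U3Letters₁₁) (hs : ℓ.Signs) (hκ : 0 < ℓ.κ)
    (hcr : betaPrime510 4 1 ℓ.κ ≤ ℓ.cr) (k : ℕ) (hdec : KernelDecayOfRecord₁₃ F N θ.toStage13Params 0 1 ℓ.κ)
    (h18 : N18At (u3OfRecord₁₃ θ.toStage13Params (objectsOfRecord₁₃ F N θ.toStage13Params ℓ) k)) :
    N17At (datumOfRecord₁₃SepCoPH F N θ hP) (u3OfRecord₁₃ θ.toStage13Params (objectsOfRecord₁₃ F N θ.toStage13Params ℓ) k) := by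
  rw [Node00.datumOfRecord₁₃SepCoPH_eq_coPH]
  exact n17At_objectsOfRecord₁₃_coPH_of_n18At θ hP.toCore ℓ hs hκ hcr k hdec h18

/-- ★ **THE CONCLUSION SPELLED — NE4 FOR def-T's `betaOfRecord₁₃` FROM N18 AT THE KERNEL OBJECTS**: at a Stage-13 tuple with core provisos, `ℓ.Signs`, `0 < ℓ.κ`,
`betaPrime510 4 1 ℓ.κ ≤ ℓ.cr`, the (5.10) clause of record and `N18At` at the objects of record (any index `k`) ⟹
`ScaleShiftRate (ℓ.cr·ℓ.C₅·ℓ.θ₅) ℓ.ρ θ.γ (betaOfRecord₁₃ F N θ.toStage13Params)` — the scale-shift rate of Bałaban's FULL β-functions of record ((1.22) read at the Stage-13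
tokens), as a by-name consequence of NODE N18's sentence at W1-20's objects.  Both inputs UNPRINTED estimates for d = 4 except (5.10); nothing discharged. [cite: Balaban1987RG1, (1.20)-(1.22) p.264 and (5.10) p.293] -/
theorem scaleShiftRate_betaOfRecord₁₃_of_n18At_objectsOfRecord₁₃ (θ : Stage13HParams F N) (hP : θ.Provisos₁₃CoPH F N) (ℓ : U3Letters₁₁) (hs : ℓ.Signs)
    (hκ : 0 < ℓ.κ) (hcr : betaPrime510 4 1 ℓ.κ ≤ ℓ.cr) (k : ℕ) (hdec : KernelDecayOfRecord₁₃ F N θ.toStage13Params 0 1 ℓ.κ)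
    (h18 : N18At (u3OfRecord₁₃ θ.toStage13Params (objectsOfRecord₁₃ F N θ.toStage13Params ℓ) k)) :
    ScaleShiftRate (ℓ.cr * ℓ.C₅ * ℓ.θ₅) ℓ.ρ θ.γ (betaOfRecord₁₃ F N θ.toStage13Params) :=
  (n17At_objectsOfRecord₁₃_datumOfRecord₁₃CoPH_iff θ hP ℓ k).mp (n17At_objectsOfRecord₁₃_coPH_of_n18At θ hP ℓ hs hκ hcr k hdec h18)

/-- **… WITH N18 IN KERNEL CURRENCY** (dag-n18-w1 `n18At_u3OfRecord₁₃_objectsOfRecord₁₃_iff`, BY NAME): the η-rate of consecutive-level entries of run A's functional of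
record along prepended sequences, `|EA k g U (pt j μ ν z) − EA k (b ∷ g) U (pt (j+1) μ ν z)| ≤ ℓ.C₅·ℓ.θ₅^{j+1}·e^{−ℓ.κ|z|₁}` for every member `b ∈ ]0,θ.γ]` and window
sequence `g`, replaces `N18At`. [cite: Balaban1987RG1, Thm 1 p.259, (1.21)-(1.22) p.264 and (5.10) p.293] -/
theorem scaleShiftRate_betaOfRecord₁₃_of_kernelStepRate (θ : Stage13HParams F N) (hP : θ.Provisos₁₃CoPH F N) (ℓ : U3Letters₁₁) (hs : ℓ.Signs)
    (hκ : 0 < ℓ.κ) (hcr : betaPrime510 4 1 ℓ.κ ≤ ℓ.cr) (k : ℕ) (hdec : KernelDecayOfRecord₁₃ F N θ.toStage13Params 0 1 ℓ.κ)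
    (hstep : ∀ b : ℝ, 0 < b → b ≤ θ.γ → ∀ g ∈ T4OutputRate.Window θ.γ, ∀ (U : PUnit) (j : ℕ) (μ ν : Fin 4) (z : Fin 4 → ℤ),
      |(objectsOfRecord₁₃ F N θ.toStage13Params ℓ).EA k g U (pt j μ ν z) -
          (objectsOfRecord₁₃ F N θ.toStage13Params ℓ).EA k (Node00.prependCoupling b g) U (pt (j + 1) μ ν z)| ≤
        ℓ.C₅ * ℓ.θ₅ ^ (j + 1) * Real.exp (-(ℓ.κ * B12Sec2to5.l1 z))) :
    ScaleShiftRate (ℓ.cr * ℓ.C₅ * ℓ.θ₅) ℓ.ρ θ.γ (betaOfRecord₁₃ F N θ.toStage13Params) :=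
  scaleShiftRate_betaOfRecord₁₃_of_n18At_objectsOfRecord₁₃ θ hP ℓ hs hκ hcr k hdec
    ((n18At_u3OfRecord₁₃_objectsOfRecord₁₃_iff F N θ.toStage13Params ℓ k).mpr hstep)

/-- ★ **THE TWO ROADS AGREE AT THE KERNEL OBJECTS**: dag-n18-w1's KERNEL ROAD (N18 in kernel currency + (UD) ⟹ `ScaleShiftRate (betaPrime510 4 (ℓ.C₅·ℓ.θ₅) ℓ.κ) ℓ.θ₅ θ.γ β₁₃`,
its `…KernelStepRateBoxes` §2∕§3; n17-a `scaleShiftRate_betaMerged_of_kernelStepRate`) lands N17 AT THE OBJECTS-OF-RECORD BUNDLE ITSELF — displayed constant `ℓ.cr·ℓ.C₅·ℓ.θ₅`, rate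
`ℓ.ρ` — EXACTLY under the (D4) input `betaPrime510 4 1 ℓ.κ ≤ ℓ.cr` and the letter signs: `betaPrime510 4 (C₅θ₅) κ = betaPrime510 4 1 κ · C₅θ₅ ≤ cr·C₅·θ₅` (dag-n27-w1
`betaPrime510_eq_one_mul`) and `θ₅ ≤ ρ` (n17-a `N17_mono`).  So the read-out domination letter of (D4) is what prices N17's constant on BOTH roads. [bookkeeping] -/
theorem n17At_objectsOfRecord₁₃_coPH_of_kernelRoad (θ : Stage13HParams F N) (hP : θ.Provisos₁₃CoPH F N) (ℓ : U3Letters₁₁) (hs : ℓ.Signs)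
    (hcr : betaPrime510 4 1 ℓ.κ ≤ ℓ.cr) (k : ℕ)
    (h : ScaleShiftRate (betaPrime510 4 (ℓ.C₅ * ℓ.θ₅) ℓ.κ) ℓ.θ₅ θ.γ (betaOfRecord₁₃ F N θ.toStage13Params)) :
    N17At (datumOfRecord₁₃CoPH F N θ hP) (u3OfRecord₁₃ θ.toStage13Params (objectsOfRecord₁₃ F N θ.toStage13Params ℓ) k) := by
  have h0 : NE4OnData (datumOfRecord₁₃CoPH F N θ hP) (betaPrime510 4 (ℓ.C₅ * ℓ.θ₅) ℓ.κ) ℓ.θ₅ θ.γ := h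
  have hC : 0 ≤ ℓ.C₅ * ℓ.θ₅ := mul_nonneg hs.C₅_nonneg hs.θ₅_pos.le
  have hc : 0 ≤ betaPrime510 4 (ℓ.C₅ * ℓ.θ₅) ℓ.κ := Beta.LimitRate.betaPrime510_nonneg hC
  have hcc' : betaPrime510 4 (ℓ.C₅ * ℓ.θ₅) ℓ.κ ≤ ℓ.cr * ℓ.C₅ * ℓ.θ₅ := by
    rw [Summit.QuantumFields.YangMills.BalabanUVNodes.N27ReadOutAtOfKernelSlices.betaPrime510_eq_one_mul]
    calc betaPrime510 4 1 ℓ.κ * (ℓ.C₅ * ℓ.θ₅) ≤ ℓ.cr * (ℓ.C₅ * ℓ.θ₅) := mul_le_mul_of_nonneg_right hcr hC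
      _ = ℓ.cr * ℓ.C₅ * ℓ.θ₅ := by ring
  exact Summit.QuantumFields.YangMills.Theorems.BalabanUVNodesN17.N17_mono _ h0 le_rfl hc hcc' hs.θ₅_pos.le hs.θ₅_le_ρ

/-- **… SO dag-n18-w1's LANDED KERNEL ROAD (p594018 `scaleShiftRate_betaMergedOfRecord_of_n18At_objectsOfRecord₁₃`, BY NAME) LANDS N17 AT THE OBJECTS BUNDLE**: `N18At` at the
objects of record (any index `k₀`), `0 < ℓ.κ`, (UD) = (5.10)-type decay of the record's limiting kernels on the boxes at some rate `δ > 0`, the letter signs and `betaPrime510 4 1 ℓ.κ ≤ ℓ.cr`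
⟹ `N17At` at the CoPH datum on the objects bundle (every index `k`).  The merged-β conclusion is read on the record's own window through the box convention (n17-a
`scaleShiftRate_betaOfMerged_iff`, `betaOfRecord₁₃ = betaOfMerged βmTχ …` by `rfl`).  Inputs = hypotheses; nothing discharged. [cite: Balaban1987RG1, (1.20)-(1.22) p.264 and (5.10) p.293] -/
theorem n17At_objectsOfRecord₁₃_coPH_of_n18At_UD (θ : Stage13HParams F N) (hP : θ.Provisos₁₃CoPH F N) (ℓ : U3Letters₁₁) (hs : ℓ.Signs) (hκ : 0 < ℓ.κ)
    (hcr : betaPrime510 4 1 ℓ.κ ≤ ℓ.cr) (k₀ k : ℕ) {C δ : ℝ} (hδ : 0 < δ)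
    (hU : letI := θ.instVβ₁; letI := θ.instVβ₂; letI := θ.instιβ
      ∀ (j : ℕ) (v : Fin (j + 1) → ℝ), v ∈ FlowStep.Box θ.γ j →
        B12Sec2to5.Decay510 (Node00.polLimit F (j + 1)
          (fun K => Node00.mergedTermFamilyMatT F N (Node00.TβOfRecord₁₃ F N) (Node00.chiβOfRecord₁₃ F N θ.toStage13Params) θ.εbg j v K) θ.ρ8 θ.bV 0 1) C δ)
    (h18 : N18At (u3OfRecord₁₃ θ.toStage13Params (objectsOfRecord₁₃ F N θ.toStage13Params ℓ) k₀)) :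
    N17At (datumOfRecord₁₃CoPH F N θ hP) (u3OfRecord₁₃ θ.toStage13Params (objectsOfRecord₁₃ F N θ.toStage13Params ℓ) k) := by
  have h := YMDAG.N18.KernelStepRateBoxes.scaleShiftRate_betaMergedOfRecord_of_n18At_objectsOfRecord₁₃ F N θ.toStage13Params ℓ k₀ h18 hκ hδ hU
  refine n17At_objectsOfRecord₁₃_coPH_of_kernelRoad θ hP ℓ hs hcr k ?_
  exact (Summit.QuantumFields.YangMills.Theorems.BalabanUVNodesN17.scaleShiftRate_betaOfMerged_iff le_rfl).mpr h

/-! ## §3 The guard-free service to K2⁷ v3's shared stub `stub_n17AtRecord13` -/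

/-- ★ **K2⁷'s `N17AtRecord13` BODY FROM N18 AT THE KERNEL OBJECTS OF RECORD** (general `N`; at `N := 2` the conclusion is the registered text by delta): if at every admissible
⁷ Stage-13 tuple SOME letter block `ℓ` carries the four read-out inputs (`ℓ.Signs`, `0 < ℓ.κ`, `betaPrime510 4 1 ℓ.κ ≤ ℓ.cr`, the (5.10) clause of record) and `N18At` at the
objects of record (at some index `k`), then `∀ F θ hP, θ.Admissible F N → ∃ u : U3Carriers, u.γ = θ.γ ∧ 0 ≤ u.ρ ∧ u.ρ < 1 ∧ N17At (datumOfRecord₁₃SepCoPH F N θ hP) u` — witness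
the objects-of-record bundle (`u.γ = θ.γ` by `rfl`; `0 ≤ ℓ.ρ < 1` from `ℓ.Signs`).  NO unity ∕ slot guard is read: this road serves K2⁷ in full (and K3⁷'s N17 conjunct a fortiori).
N18 at the kernel objects and (5.10) are HYPOTHESES; nothing discharged. [cite: Balaban1987RG1, (1.20)-(1.22) p.264 and (5.10) p.293] -/
theorem n17AtRecord13Body_of_n18At_objectsOfRecord₁₃
    (h : ∀ (F : T4Family) (θ : Stage13HParams F N) (hP : θ.Provisos₁₃SepCoPH F N), θ.Admissible F N →
      ∃ (ℓ : U3Letters₁₁) (k : ℕ), ℓ.Signs ∧ 0 < ℓ.κ ∧ betaPrime510 4 1 ℓ.κ ≤ ℓ.cr ∧ KernelDecayOfRecord₁₃ F N θ.toStage13Params 0 1 ℓ.κ ∧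
        N18At (u3OfRecord₁₃ θ.toStage13Params (objectsOfRecord₁₃ F N θ.toStage13Params ℓ) k)) :
    ∀ (F : T4Family) (θ : Stage13HParams F N) (hP : θ.Provisos₁₃SepCoPH F N), θ.Admissible F N →
      ∃ u : U3Carriers, u.γ = θ.γ ∧ 0 ≤ u.ρ ∧ u.ρ < 1 ∧ N17At (datumOfRecord₁₃SepCoPH F N θ hP) u := by
  intro F θ hP hθ
  obtain ⟨ℓ, k, hs, hκ, hcr, hdec, h18⟩ := h F θ hP hθ
  exact ⟨u3OfRecord₁₃ θ.toStage13Params (objectsOfRecord₁₃ F N θ.toStage13Params ℓ) k, rfl, hs.ρ_nonneg, hs.ρ_lt_one,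
    n17At_objectsOfRecord₁₃_sepCoPH_of_n18At θ hP ℓ hs hκ hcr k hdec h18⟩

/-- **THE SAME WITH A KEYED LETTER BLOCK `ℓ F θ`** (the shape dag-n27-w1's `forall_readOutAt_objectsOfRecord₁₃_coPH` and the K3⁷ v3 cut use: one block per tuple, its inputs as
four keyed sentences, N18 as a fifth). [bookkeeping] -/
theorem n17AtRecord13Body_of_n18At_objectsOfRecord₁₃_keyed (ℓ : (F : T4Family) → Stage13HParams F N → U3Letters₁₁) (k : ℕ)
    (hs : ∀ (F : T4Family) (θ : Stage13HParams F N), θ.Provisos₁₃SepCoPH F N → θ.Admissible F N → (ℓ F θ).Signs)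
    (hκ : ∀ (F : T4Family) (θ : Stage13HParams F N), θ.Provisos₁₃SepCoPH F N → θ.Admissible F N → 0 < (ℓ F θ).κ)
    (hcr : ∀ (F : T4Family) (θ : Stage13HParams F N), θ.Provisos₁₃SepCoPH F N → θ.Admissible F N → betaPrime510 4 1 (ℓ F θ).κ ≤ (ℓ F θ).cr)
    (hdec : ∀ (F : T4Family) (θ : Stage13HParams F N), θ.Provisos₁₃SepCoPH F N → θ.Admissible F N → KernelDecayOfRecord₁₃ F N θ.toStage13Params 0 1 (ℓ F θ).κ)
    (h18 : ∀ (F : T4Family) (θ : Stage13HParams F N), θ.Provisos₁₃SepCoPH F N → θ.Admissible F N →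
      N18At (u3OfRecord₁₃ θ.toStage13Params (objectsOfRecord₁₃ F N θ.toStage13Params (ℓ F θ)) k)) :
    ∀ (F : T4Family) (θ : Stage13HParams F N) (hP : θ.Provisos₁₃SepCoPH F N), θ.Admissible F N →
      ∃ u : U3Carriers, u.γ = θ.γ ∧ 0 ≤ u.ρ ∧ u.ρ < 1 ∧ N17At (datumOfRecord₁₃SepCoPH F N θ hP) u :=
  n17AtRecord13Body_of_n18At_objectsOfRecord₁₃ fun F θ hP hθ =>
    ⟨ℓ F θ, k, hs F θ hP hθ, hκ F θ hP hθ, hcr F θ hP hθ, hdec F θ hP hθ, h18 F θ hP hθ⟩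

/-! ## §4 The pin form (reading side): what a K3⁷ stub-1 prover at a reading pinned to the kernel objects gets for N17 -/

/-- **THE N17 CONJUNCT UNDER THE PIN READS AS §1's SENTENCE** (every run-length bundle; `Iff.rfl` after the pin). [bookkeeping] -/
theorem n17At_rateCarriers_of_kernels_pin_iff (𝔯 : RateReading₁₃CoPH N) (θ : Stage13HParams F N) (hP : θ.Provisos₁₃CoPH F N) (g₀ : ℕ → ℝ) (os : List (ULoop F))
    (ℓ : U3Letters₁₁) (hpin : (𝔯.lit F θ hP g₀ os).u3 = objectsOfRecord₁₃ F N θ.toStage13Params ℓ) (k : ℕ) :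
    N17At (datumOfRecord₁₃CoPH F N θ hP) (rateCarriersOfRecord₁₃CoPH 𝔯 F θ hP g₀ os k).u3 ↔
      ScaleShiftRate (ℓ.cr * ℓ.C₅ * ℓ.θ₅) ℓ.ρ θ.γ (betaOfRecord₁₃ F N θ.toStage13Params) := by
  show N17At (datumOfRecord₁₃CoPH F N θ hP) (u3OfRecord₁₃ θ.toStage13Params (𝔯.lit F θ hP g₀ os).u3 k) ↔ _
  rw [hpin]
  exact n17At_objectsOfRecord₁₃_datumOfRecord₁₃CoPH_iff θ hP ℓ k

/-- ★ **THE N17 CONJUNCT UNDER THE PIN FROM THE N18 CONJUNCT + THE FOUR READ-OUT INPUTS** (every run-length bundle `k` — in particular the selected one `ksel …` of K3⁷ v2's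
`KeyedRatesHolderD4`, and whatever K3⁷ v3 selects): NO N22, NO (D4) hypothesis. [cite: Balaban1987RG1, (1.20)-(1.22) p.264 and (5.10) p.293] -/
theorem n17At_rateCarriers_of_kernels_pin_of_n18At (𝔯 : RateReading₁₃CoPH N) (θ : Stage13HParams F N) (hP : θ.Provisos₁₃CoPH F N) (g₀ : ℕ → ℝ)
    (os : List (ULoop F)) (ℓ : U3Letters₁₁) (hpin : (𝔯.lit F θ hP g₀ os).u3 = objectsOfRecord₁₃ F N θ.toStage13Params ℓ) (hs : ℓ.Signs) (hκ : 0 < ℓ.κ)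
    (hcr : betaPrime510 4 1 ℓ.κ ≤ ℓ.cr) (hdec : KernelDecayOfRecord₁₃ F N θ.toStage13Params 0 1 ℓ.κ) (k : ℕ)
    (h18 : N18At (rateCarriersOfRecord₁₃CoPH 𝔯 F θ hP g₀ os k).u3) :
    N17At (datumOfRecord₁₃CoPH F N θ hP) (rateCarriersOfRecord₁₃CoPH 𝔯 F θ hP g₀ os k).u3 := by
  change N18At (u3OfRecord₁₃ θ.toStage13Params (𝔯.lit F θ hP g₀ os).u3 k) at h18
  show N17At (datumOfRecord₁₃CoPH F N θ hP) (u3OfRecord₁₃ θ.toStage13Params (𝔯.lit F θ hP g₀ os).u3 k)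
  rw [hpin] at h18 ⊢
  exact n17At_objectsOfRecord₁₃_coPH_of_n18At θ hP ℓ hs hκ hcr k hdec h18

end YMDAG.N17.AtU3OfKernels

end
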